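import Mathlib
import Literature.AlgebraicGeometry.Resolution.CobordantVertexChart
import Literature.AlgebraicGeometry.Resolution.CobordantChartOneMove

/-!
# Cobordant chart, III: singular cone points, and the Brieskorn–Pham calibration

Continuation of `CobordantChartCoefficients.lean` / `CobordantChartOneMove.lean` (crux
`LocalWeightedDrop`, stmt-ResolutionOfSingularities-8899; cdisprove refuter).

* `exists_singular_successor_of_cone_singular` — for a non-zero `w`-homogeneous polynomial germ
  `P` and an exceptional point `c` (crux convention: `c_i = 0` where `w_i = 0`) with `P(c) = 0`,
  `∇P(c) = 0`, the `s`-saturated transform at `c` under `(θ = X, w)` exists (the `s`-saturation is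
  `CobordantVertexChart.exists_eq_X_pow_mul_not_dvd`) and is SINGULAR.  With the one-move-win
  theorem of part II this gives: `(X, w)` wins in one move from `P` iff the affine cone `{P = 0}`
  has no singular point `c ≠ 0` with `c_i = 0` for all `i` with `w_i = 0` (for all-positive
  weights: iff the cone is smooth off the vertex) — the refuter's resource is exactly the singular
  locus of weighted tangent cones;
* `bpPoly`, `bpWeight`, `bp_cone_smooth`, `bp_won_in_one_move` — over EVERY field, a
  Brieskorn–Pham germ `∑ xᵢ^{aᵢ}` with at most one exponent divisible by the characteristic is won
  in one move by `θ = X` and the balanced weights `wᵢ = ∏_{j≠i} aⱼ` (Włodarczyk arXiv:2203.03090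
  Thm 4.2.2 in the cobordant-chart language of the crux, literal chart/guard form).
-/

namespace Literature.AlgebraicGeometry.Resolution.CobordantChart

open MvPolynomial

variable {k : Type*} [Field k] {n : ℕ}

/-! ### The converse: a singular cone point IS a singular successor (homogeneous germs) -/

/-- SINGULAR CONE POINT ⇒ SINGULAR SUCCESSOR.  For a non-zero `w`-homogeneous polynomial germ `P`
and an exceptional point `c` (crux convention) with `P(c) = 0` and `∇P(c) = 0`, the
`s`-saturated transform at `c` under the move `(θ = X, w)` exists and IS singular.  Together with
`successor_nonsingular_of_isWeightedHomogeneous`: `(X, w)` wins in one move from `P` iff the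
affine cone of `P` has no singular point `c ≠ 0` satisfying the chart convention `c_i = 0` for
`w_i = 0` (when all weights are positive: iff the cone is smooth off the vertex). [folklore] -/
theorem exists_singular_successor_of_cone_singular (w : Fin n → ℕ) {P : MvPolynomial (Fin n) k}
    {a : ℕ} (hP : P.IsWeightedHomogeneous w a) (hP0 : P ≠ 0)
    (c : Fin n → k) (hc : ∀ i, w i = 0 → c i = 0)
    (h0 : MvPolynomial.eval c P = 0) (h1 : ∀ i, MvPolynomial.eval c (MvPolynomial.pderiv i P) = 0) :
    ∃ (e : ℕ) (g : MvPowerSeries (Fin (n + 1)) k),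
      MvPowerSeries.subst (chart w c) (P : MvPowerSeries (Fin n) k) = MvPowerSeries.X 0 ^ e * g ∧
      ¬ MvPowerSeries.X 0 ∣ g ∧
      (MvPowerSeries.constantCoeff g = 0 ∧ ∀ j, MvPowerSeries.coeff (Finsupp.single j 1) g = 0) := by
  classical
  have hP0' : (P : MvPowerSeries (Fin n) k) ≠ 0 := by
    intro h; apply hP0; exact MvPolynomial.coe_eq_zero_iff.mp h
  obtain ⟨e, g, hfac, hg⟩ :=
    CobordantVertexChart.exists_eq_X_pow_mul_not_dvd (subst_chart_ne_zero w c hc hP0')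
  refine ⟨e, g, hfac, hg, ?_⟩
  have he : e = a := by
    have h1 := eq_weightedOrder_of_factor w c hc hP0' hfac hg
    rw [weightedOrder_coe_of_isWeightedHomogeneous w hP hP0] at h1
    exact_mod_cast h1
  subst he
  rw [successor_singular_iff w c hc _ hfac]
  refine ⟨?_, fun i => ?_, ?_⟩
  · rw [initEval_coe, hP.weightedHomogeneousComponent_same]; exact h0
  · rw [initEvalD_coe, hP.weightedHomogeneousComponent_same]; exact h1 i
  · rw [initEval_coe, hP.weightedHomogeneousComponent_ne (e + 1) (by omega), map_zero]


/-! ### Calibration: Brieskorn–Pham germs with at most one `p`-divisible exponent -/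

/-- The Brieskorn–Pham polynomial `∑ᵢ Xᵢ^{aᵢ}`. [folklore] -/
noncomputable def bpPoly (k : Type*) [Field k] (a : Fin n → ℕ) : MvPolynomial (Fin n) k :=
  ∑ i, X i ^ (a i)

/-- Balanced weights `wᵢ = ∏_{j ≠ i} aⱼ` (so `wᵢ aᵢ = ∏ aⱼ` for every `i`, no divisibility needed). [folklore] -/
def bpWeight (a : Fin n → ℕ) : Fin n → ℕ := fun i => ∏ j ∈ Finset.univ.erase i, a j

/-- `bpWeight_mul` (see the module docstring). [folklore] -/
theorem bpWeight_mul (a : Fin n → ℕ) (i : Fin n) : bpWeight a i * a i = ∏ j, a j := by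
  rw [bpWeight, mul_comm, Finset.mul_prod_erase _ _ (Finset.mem_univ i)]

/-- `bpPoly_isWeightedHomogeneous` (see the module docstring). [folklore] -/
theorem bpPoly_isWeightedHomogeneous (k : Type*) [Field k] (a : Fin n → ℕ) :
    (bpPoly k a).IsWeightedHomogeneous (bpWeight a) (∏ j, a j) := by
  unfold bpPoly
  apply MvPolynomial.IsWeightedHomogeneous.sum
  intro i _
  have := (MvPolynomial.isWeightedHomogeneous_X (R := k) (bpWeight a) i).pow (a i)
  rwa [smul_eq_mul, mul_comm, bpWeight_mul] at this
  -- note: `pow` gives degree `a i • w i`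

/-- `bpPoly_ne_zero` (see the module docstring). [folklore] -/
theorem bpPoly_ne_zero (k : Type*) [Field k] [NeZero n] (a : Fin n → ℕ) (ha : ∀ i, 1 ≤ a i) :
    bpPoly k a ≠ 0 := by
  classical
  intro h
  have := congrArg (MvPolynomial.coeff (Finsupp.single (0 : Fin n) (a 0))) h
  rw [bpPoly, MvPolynomial.coeff_sum, MvPolynomial.coeff_zero] at this
  rw [Finset.sum_eq_single (0 : Fin n)] at this
  · simp [MvPolynomial.coeff_X_pow] at this
  · intro j _ hj
    rw [MvPolynomial.coeff_X_pow, if_neg]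
    intro heq
    have h1 := congrArg (fun e => e j) heq
    simp only [Finsupp.single_eq_same, Finsupp.single_apply] at h1
    rw [if_neg (Ne.symm hj)] at h1
    have := ha j
    omega
  · simp

/-- The affine cone of a Brieskorn–Pham polynomial with AT MOST ONE exponent vanishing in `k`
(`p ∣ aᵢ` for at most one `i`) is smooth off the origin. [folklore] -/
theorem bp_cone_smooth (k : Type*) [Field k] (a : Fin n → ℕ) (ha : ∀ i, 1 ≤ a i)
    (hp : ∀ i j, i ≠ j → ((a i : ℕ) : k) = 0 → ((a j : ℕ) : k) ≠ 0) (c : Fin n → k)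
    (h0 : MvPolynomial.eval c (bpPoly k a) = 0)
    (h1 : ∀ i, MvPolynomial.eval c (MvPolynomial.pderiv i (bpPoly k a)) = 0) : c = 0 := by
  classical
  -- ∂ᵢ P = aᵢ Xᵢ^{aᵢ - 1}
  have hd : ∀ i, MvPolynomial.pderiv i (bpPoly k a) = (a i : MvPolynomial (Fin n) k) * X i ^ (a i - 1) := by
    intro i
    rw [bpPoly, map_sum, Finset.sum_eq_single i]
    · rw [Derivation.leibniz_pow, MvPolynomial.pderiv_X_self, smul_eq_mul, mul_one, nsmul_eq_mul]
    · intro j _ hji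
      rw [Derivation.leibniz_pow, MvPolynomial.pderiv_X_of_ne hji, smul_zero, smul_zero]
    · simp
  have hc : ∀ i, ((a i : ℕ) : k) ≠ 0 → c i = 0 := by
    intro i hai
    have := h1 i
    rw [hd i] at this
    simp only [map_mul, map_natCast, map_pow, MvPolynomial.eval_X, mul_eq_zero] at this
    rcases this with h | h
    · exact absurd h hai
    · by_cases ha1 : a i = 1
      · -- then ∂ᵢP = 1 ≠ 0: contradiction already
        rw [ha1] at h; simp at h
      · exact pow_eq_zero_iff (by have := ha i; omega) |>.mp h
  -- at most one index is `p`-divisible; all others vanish, then that one too by `P(c) = 0`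
  by_cases hall : ∀ i, ((a i : ℕ) : k) ≠ 0
  · funext i; exact hc i (hall i)
  · push Not at hall
    obtain ⟨i₀, hi₀⟩ := hall
    have hothers : ∀ j, j ≠ i₀ → c j = 0 := fun j hj => hc j (hp i₀ j (Ne.symm hj) hi₀)
    have hci₀ : c i₀ = 0 := by
      rw [bpPoly, map_sum, Finset.sum_eq_single i₀] at h0
      · simp only [map_pow, MvPolynomial.eval_X] at h0
        exact pow_eq_zero_iff (by have := ha i₀; omega) |>.mp h0
      · intro j _ hj
        rw [map_pow, MvPolynomial.eval_X, hothers j hj, zero_pow (by have := ha j; omega)]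
      · simp
    funext i
    by_cases hi : i = i₀
    · rw [hi, hci₀]; rfl
    · rw [hothers i hi]; rfl

/-- CALIBRATION (every field `k`): a Brieskorn–Pham germ `∑ xᵢ^{aᵢ}` (`aᵢ ≥ 1`, `n ≥ 1`) with at
most one exponent divisible by `char k` is WON IN ONE MOVE by `θ = X` and the balanced weights
`wᵢ = ∏_{j≠i} aⱼ`: no singular `s`-saturated successor on `B₊`, in the crux's literal form.
(With two `p`-divisible exponents the cone `{xᵢ^{aᵢ} + xⱼ^{aⱼ} = 0}` is singular and
`exists_singular_successor_of_cone_singular` gives a singular successor for THIS move.) [folklore] -/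
theorem bp_won_in_one_move (k : Type*) [Field k] [NeZero n] (a : Fin n → ℕ) (ha : ∀ i, 1 ≤ a i)
    (hp : ∀ i j, i ≠ j → ((a i : ℕ) : k) = 0 → ((a j : ℕ) : k) ≠ 0)
    (c : Fin n → k) (hoff : ∃ i, 0 < bpWeight a i ∧ c i ≠ 0) (e : ℕ)
    (g : MvPowerSeries (Fin (n + 1)) k)
    (hfac : MvPowerSeries.subst (fun i : Fin n => if 0 < bpWeight a i then
        MvPowerSeries.X (0 : Fin (n + 1)) ^ (bpWeight a i) *
          (MvPowerSeries.C (c i) + MvPowerSeries.X i.succ)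
        else MvPowerSeries.X i.succ)
        (MvPowerSeries.subst (MvPowerSeries.X : Fin n → MvPowerSeries (Fin n) k)
          (bpPoly k a : MvPowerSeries (Fin n) k)) = MvPowerSeries.X 0 ^ e * g)
    (hg : ¬ MvPowerSeries.X 0 ∣ g) :
    ¬ (MvPowerSeries.constantCoeff g = 0 ∧ ∀ j, MvPowerSeries.coeff (Finsupp.single j 1) g = 0) :=
  crux_move_wins_of_isWeightedHomogeneous _ (bpPoly_isWeightedHomogeneous k a)
    (bpPoly_ne_zero k a ha) (bp_cone_smooth k a ha hp) c hoff e g hfac hg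


end Literature.AlgebraicGeometry.Resolution.CobordantChart
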